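import Summits.QuantumFields.BalabanUV.Beta.FP.PeriodisedBorderWardContact

/-!
# `BalabanUV.Beta.FP.PeriodisedGaugeLegContacts` — road «FP», ROUTE T, binder row D1: **THE PERIOD-LATTICE ENGINE FOR A FLUCTUATION-LEG LAW WITH ANY
# RIGHT-HAND SIDE** (the generalisation of leaf-02 g17's `PeriodisedBorderWardContact.sum_perZ_dper_mul_tgrad_of_gaugeLeg` that the ORDER-2 row `c2` needs)

WHAT ([folklore] finite sums BY NAME; `sum_perZ_mul_tgrad` of g17 + the copy bookkeeping of `dper`).  **`sum_perZ_dper_mul_tgrad_of_law`**: for an insertion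
family `V κ u` that is (i) JOINTLY INVARIANT under the period lattice in (bond, sites) — `V κ (u + M∘m) (x + M∘m) (z + M∘m) = V κ u x z` (weaker than block
covariance at a blocking `N ∣ M`; it is the form a second-bond-periodised two-bond table has in its free bond, `PeriodisedSymBorderT2IndexWard.borderT2per_periodCov`),
(ii) finitely supported in the fluctuation slot and in the family bond for a fixed multiplier site, and (iii) whose `dψ`-form fluctuation-leg law against the
periodic indicators `ψ = tdelta M · s` has ANY right-hand side `R κ u x μ s`, the periodised insertion against a torus gauge-mode column is the copy sum of the law:
`Σ_{y,α} perZ M (dper M (V κ u)) x y (inr μ) (inl α)·tgrad M (y, inl α) s = Σ'_m R κ (u + M∘m) x μ s`; **`submatrix_mul_tgrad_of_law`** the matrix form at slot maps.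
No `def`, no `def … : Prop`, nothing cited, 0 sorry.  Consumer: `PeriodisedSymBorderWardContactTwo` (the (0.4) row table, four contact terms).

HONEST DEPENDENCY (page 1, mandatory): continuum YM on T⁴ ⇐ BetaPertH ∧ nine spine estimates (0/9 proved); BetaPertH ⇐ (D1) ∧ (D4) ∧ CAP+tail;
G-an2-4 gates asym, D1 and NE2/3/4.  HONEST FRAMING (cell contract, verbatim): «discharging `BetaPertH` makes Bałaban's UV stability UNCONDITIONAL —
a real constructive-QFT result; it is NOT the continuum limit and NOT the Clay problem.»  ABSOLUTE RULE (cell charter, verbatim): «No internally-minted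
statement may enter as a cited fact. Every hypothesis is either kernel-proved in this package or a verbatim quotation of a PUBLISHED theorem with page
reference. The manuscript(s) under audit are NOT citable for their own disputed steps — they are the thing under adjudication; programme-internal
(2001/route/tribunal) claims are never citable.»  0 estimates; 0∕4 row-D1 binders (hW, hR, D1Tel, D1Rep); NOT (T-ID), NOT (J-a) complete, NOT SDF, NOT D1,
NOT BetaPertH, NOT continuum, NOT Clay.  D1 formalisation swarm LEAF PROVER 02 (b2b-balaban-beta-d1-formalise-leaf-02 gen 23), 2026-08-23.  No existing file touched.
-/

noncomputable section

open scoped BigOperators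

namespace Summit.QuantumFields.BalabanUV.Beta.FP.PeriodisedGaugeLegContacts

open Finset
open Literature.MathematicalPhysics.QuantumFieldTheory.Balaban1983to89
open Literature.MathematicalPhysics.QuantumFieldTheory.Balaban1983to89.Beta
open B4TorusKernel.MultiPeriod (translate translate_apply)
open B4Reflection242 (translate_translate)
open B6Lemma24Torus (pbox mem_pbox)
open ExpKernelCalculus (MKer shiftK)
open AffineAveraging (Site box toSite unitVec dz)
open OneStepResolventKernel (Fib)
open Summit.QuantumFields.BalabanUV.Beta.FP.KernelPeriodisationFib (Idx perF perF_apply perZ perZ_apply)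
open Summit.QuantumFields.BalabanUV.Beta.FP.KernelPeriodisationFibLoc (dper dper_apply)
open Summit.QuantumFields.BalabanUV.Beta.FP.TorusGaugeCovariance (tdelta tgrad)
open Summit.QuantumFields.BalabanUV.Beta.FP.PeriodisedBorderWardContact (sum_perZ_mul_tgrad)

variable {d : ℕ}

section Generic

variable {M : Fin (d + 1) → ℕ} [∀ μ, NeZero (M μ)]
  (V : Fin (d + 1) → Site (d + 1) → MKer (d + 1) (Fib d))
  (R : Fin (d + 1) → Site (d + 1) → Site (d + 1) → Fin (d + 1) → ↥(pbox M) → ℝ)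
  (S T : Site (d + 1) → Finset (Site (d + 1)))

/-- [folklore] **`sum_perZ_dper_mul_tgrad_of_law` — A PERIOD-COVARIANT INSERTION FAMILY AGAINST A TORUS GAUGE-MODE COLUMN IS THE PERIOD SUM OF ITS LATTICE
FLUCTUATION-LEG LAW.**  Letters: `hVP` joint invariance of the family `V` under the period lattice in (bond, sites) — weaker than block covariance at a
blocking `N ∣ M` (`PeriodisedBorderTables.apply_translate_of_blockCov`), and the form a second-bond-periodised two-bond table has in its free bond
(`PeriodisedSymBorderT2IndexWard.borderT2per_periodCov`); `hS` finite support of the `(inr, inl)` entries in the fluctuation slot; `hT` finite support in the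
family bond for a fixed multiplier site; `hlaw` the `dψ`-form of the family's fluctuation-leg law AGAINST THE PERIODIC INDICATORS `ψ = tdelta M · s`, with ANY
right-hand side `R κ u x μ s`.  Conclusion: `Σ_{y,α} perZ M (dper M (V κ u)) x y (inr μ) (inl α)·tgrad M (y, inl α) s = Σ'_m R κ (u + M∘m) x μ s`
(the copies of the bond loading the multiplier site are finitely many, `hT`). -/
theorem sum_perZ_dper_mul_tgrad_of_law
    (hVP : ∀ (κ : Fin (d + 1)) (u m x z : Site (d + 1)) (a c : Fib d), V κ (translate M u m) (translate M x m) (translate M z m) a c = V κ u x z a c)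
    (hS : ∀ (κ : Fin (d + 1)) (u x : Site (d + 1)) (μ α : Fin (d + 1)), ∀ z ∉ S x, V κ u x z (Sum.inr μ) (Sum.inl α) = 0)
    (hT : ∀ (κ : Fin (d + 1)) (x z : Site (d + 1)) (μ α : Fin (d + 1)), ∀ u ∉ T x, V κ u x z (Sum.inr μ) (Sum.inl α) = 0)
    (hlaw : ∀ (κ : Fin (d + 1)) (u x : Site (d + 1)) (μ : Fin (d + 1)) (s : ↥(pbox M)),
      ∑' z, ∑ α, V κ u x z (Sum.inr μ) (Sum.inl α) * dz (fun w => tdelta M w s) α z = R κ u x μ s)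
    (κ : Fin (d + 1)) (u x : Site (d + 1)) (μ : Fin (d + 1)) (s : ↥(pbox M)) :
    ∑ y : ↥(pbox M), ∑ α : Fin (d + 1), perZ M (dper M (V κ u)) x (y : Site (d + 1)) (Sum.inr μ) (Sum.inl α) * tgrad M (y, Sum.inl α) s
      = ∑' m : Site (d + 1), R κ (translate M u m) x μ s := by
  -- the copies of the insertion bond that load the multiplier site `x` are finitely many
  have hinj : Function.Injective fun m : Site (d + 1) => translate M u m := by
    intro m m' h
    funext i
    have hi := congrFun h i
    simp only [translate_apply] at hi
    have hMi : (M i : ℤ) ≠ 0 := by exact_mod_cast NeZero.ne (M i)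
    exact mul_left_cancel₀ hMi (by linarith)
  set F : Finset (Site (d + 1)) := (T x).preimage (fun m => translate M u m) hinj.injOn with hF
  have hF' : ∀ m ∉ F, translate M u m ∉ T x := fun m hm ht => hm (Finset.mem_preimage.2 ht)
  -- one translated copy: `V κ u (x + M∘m) (z + M∘m) = V κ (u − M∘m) x z` (period covariance; `(u − M∘m) + M∘m = u`)
  have hcopy0 : ∀ (m z : Site (d + 1)) (a c : Fib d), V κ u (translate M x m) (translate M z m) a c = V κ (translate M u (-m)) x z a c := by
    intro m z a c
    have hu : translate M (translate M u (-m)) m = u := by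
      rw [translate_translate, neg_add_cancel]; funext i; rw [translate_apply, Pi.zero_apply, mul_zero, add_zero]
    rw [← hVP κ (translate M u (-m)) m x z a c, hu]
  have hdper : ∀ (z : Site (d + 1)) (α : Fin (d + 1)),
      dper M (V κ u) x z (Sum.inr μ) (Sum.inl α) = ∑ m ∈ F, V κ (translate M u m) x z (Sum.inr μ) (Sum.inl α) := fun z α => by
    have h0 : dper M (V κ u) x z (Sum.inr μ) (Sum.inl α) = ∑' m : Site (d + 1), V κ (translate M u m) x z (Sum.inr μ) (Sum.inl α) := by
      rw [dper_apply, ← (Equiv.neg (Site (d + 1))).tsum_eq fun m => V κ (translate M u m) x z (Sum.inr μ) (Sum.inl α)]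
      exact tsum_congr fun m => by rw [hcopy0, Equiv.neg_apply]
    rw [h0]
    exact tsum_eq_sum fun m hm => hT κ x z μ α _ (hF' m hm)
  have hK : ∀ (α : Fin (d + 1)) (g : Site (d + 1) → ℝ), Summable fun z => dper M (V κ u) x z (Sum.inr μ) (Sum.inl α) * g z := by
    intro α g
    refine summable_of_ne_finset_zero (s := S x) fun z hz => ?_
    rw [hdper, Finset.sum_eq_zero fun m _ => hS κ _ x μ α z hz, zero_mul]
  rw [sum_perZ_mul_tgrad M (dper M (V κ u)) x μ s hK]
  have hswap : ∑' z : Site (d + 1), ∑ α : Fin (d + 1), dper M (V κ u) x z (Sum.inr μ) (Sum.inl α) * dz (fun w => tdelta M w s) α z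
      = ∑ m ∈ F, ∑' z : Site (d + 1), ∑ α : Fin (d + 1), V κ (translate M u m) x z (Sum.inr μ) (Sum.inl α) * dz (fun w => tdelta M w s) α z := by
    have hsm : ∀ m ∈ F, Summable fun z => ∑ α : Fin (d + 1), V κ (translate M u m) x z (Sum.inr μ) (Sum.inl α) * dz (fun w => tdelta M w s) α z :=
      fun m _ => summable_of_ne_finset_zero (s := S x) fun z hz => Finset.sum_eq_zero fun α _ => by rw [hS κ _ x μ α z hz, zero_mul]
    rw [← Summable.tsum_finsetSum hsm]
    refine tsum_congr fun z => ?_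
    rw [Finset.sum_comm]
    refine Finset.sum_congr rfl fun α _ => ?_
    rw [hdper z α, Finset.sum_mul]
  rw [hswap, Finset.sum_congr rfl fun m _ => hlaw κ (translate M u m) x μ s]
  -- off `F` the law's right-hand side vanishes (its left-hand side does, by `hT`)
  refine (tsum_eq_sum fun m hm => ?_).symm
  rw [← hlaw κ (translate M u m) x μ s]
  exact (tsum_congr fun z => Finset.sum_eq_zero fun α _ => by rw [hT κ x z μ α _ (hF' m hm), zero_mul]).trans tsum_zero

/-- [folklore] **MATRIX FORM AT SLOT MAPS** (field slots `fν b = (b.1, inl b.2)`; multiplier slots `a ↦ (pμ a, inr (mμ a))`; columns of `tgrad` through `g`). -/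
theorem submatrix_mul_tgrad_of_law
    (hVP : ∀ (κ : Fin (d + 1)) (u m x z : Site (d + 1)) (a c : Fib d), V κ (translate M u m) (translate M x m) (translate M z m) a c = V κ u x z a c)
    (hS : ∀ (κ : Fin (d + 1)) (u x : Site (d + 1)) (μ α : Fin (d + 1)), ∀ z ∉ S x, V κ u x z (Sum.inr μ) (Sum.inl α) = 0)
    (hT : ∀ (κ : Fin (d + 1)) (x z : Site (d + 1)) (μ α : Fin (d + 1)), ∀ u ∉ T x, V κ u x z (Sum.inr μ) (Sum.inl α) = 0)
    (hlaw : ∀ (κ : Fin (d + 1)) (u x : Site (d + 1)) (μ : Fin (d + 1)) (s : ↥(pbox M)),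
      ∑' z, ∑ α, V κ u x z (Sum.inr μ) (Sum.inl α) * dz (fun w => tdelta M w s) α z = R κ u x μ s)
    {μI γ : Type*} (pμ : μI → Site (d + 1)) (hpμ : ∀ a, pμ a ∈ pbox M) (mμ : μI → Fin (d + 1)) (g : γ → ↥(pbox M))
    (κ : Fin (d + 1)) (u : Site (d + 1)) (a : μI) (c : γ) :
    ((perF M (dper M (V κ u))).submatrix (fun a : μI => ((⟨pμ a, hpμ a⟩, Sum.inr (mμ a)) : Idx M (Fib d)))
          (fun b : ↥(pbox M) × Fin (d + 1) => ((b.1, Sum.inl b.2) : Idx M (Fib d)))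
        * (tgrad M).submatrix (fun b : ↥(pbox M) × Fin (d + 1) => ((b.1, Sum.inl b.2) : Idx M (Fib d))) g) a c
      = ∑' m : Site (d + 1), R κ (translate M u m) (pμ a) (mμ a) (g c) := by
  rw [Matrix.mul_apply, Fintype.sum_prod_type]
  simp only [Matrix.submatrix_apply, perF_apply]
  exact sum_perZ_dper_mul_tgrad_of_law V R S T hVP hS hT hlaw κ u (pμ a) (mμ a) (g c)

end Generic

end Summit.QuantumFields.BalabanUV.Beta.FP.PeriodisedGaugeLegContacts

end
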